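/-
Copyright (c) 2026 the pub-hodgecm-mathlib formalisation cell (harness21).  Prover seat hodgecm-mathlib-K2E3-p17 (g6), Track B «K2-LIT» ∕ h413
(`stmt-HodgeConjecture-24833`), line `K2_E3_EllipticInputs`, unit U12 §L, Richardson road for (LBGL-ge3) at `N = 3` (road owner K2E3-p11 (g4)),
brick (F-J) = (S-B♭)_Lie, FILE E1 «THE ORBIT CHART AT A REGULAR DIAGONAL POINT OF 𝔤𝔩₃: ALGEBRA AND STRICT DERIVATIVE».  2026-09-04.
-/
import Literature.Analysis.Matrix.UltrametricElementwiseNormCalculus      -- ★ (F0P3a-p05): `norm_mul_le_of_isUltrametricDist` (elementwise sup norm is submultiplicative)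
import Mathlib.LinearAlgebra.Matrix.Charpoly.Basic
import Mathlib.Topology.Algebra.Module.FiniteDimension
import Mathlib.Analysis.Normed.Module.FiniteDimension
import HarnessLib

/-!
# K2_E3 road (h413), §L ∕ Richardson road at `N = 3`, brick (F-J) FILE E1: the orbit chart `Ψ_t(X) = Ad((1+X⁺)(1+X⁻))(t + X_d)` — algebra and strict derivative

Cell `pub/hodgecm-mathlib` (D-0151), Track B, seat K2E3-p17 (g6), deal (D60) of the dealer K2E3-plan (g3) = (F-J) of the Richardson road owner K2E3-p11 (g4)
(`K2/K2E3-p17/g6/CENSUS-SBflatLie-N3.K2E3-p17-g6.md` §1 (iii), brick E).  `--supports stmt-HodgeConjecture-24833 --as helper`; THEOREMS ONLY (no definition ∕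
instance ∕ notation ∕ named fact ∕ `sorry`); never imports `Cruxes/…/Lines`.  COUNT-NEUTRAL.

THE POINT.  The (F-J) head `K2E3GL3BorelSliceDensity.exists_borelSliceDensity` (the 𝔤𝔩₃ twin of ★ p857186) is the Weyl integration formula for the split Cartan of
`𝔤𝔩₃(F)`.  Its local form at a regular diagonal `t = diagonal d` needs NO Jacobian computed by hand: the polynomial map
  `Ψ_t(X) = (1 + X⁺)(1 + X⁻) · (t + X_d) · (1 + X⁻)⁻¹(1 + X⁺)⁻¹`     (`X⁺ ∕ X⁻ ∕ X_d` = strictly upper ∕ strictly lower ∕ diagonal part of `X ∈ M₃`)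
has strict derivative at `0` the ENTRYWISE SCALING `e_t(X)_{ij} = (d_j − d_i) X_{ij}` (`i ≠ j`), `X_{ii}` (`i = j`) — a linear automorphism when `d` is injective.
FILE E2 (`K2E3GL3RegularDiagonalOrbitChart`) feeds this to ★ `exists_depth_chart` (Schikhof §27) over the local field.
* §1 algebra over a commutative ring: the parts `X⁺, X⁻, X_d`, the unipotent inverses `(1 + X^±)⁻¹ = 1 − X^± + (X^±)²`, `Ψ_t(X) = g·diagonal(d + diag X)·g⁻¹` with
  `g = (1+X⁺)(1+X⁻) ∈ GL₃`, `charpoly` invariance, `Ψ_t(0) = t`, the entrywise derivative identity.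
* §2 over a complete ultrametric normed field `K` (elementwise sup norm): **`hasStrictFDerivAt_orbitChart`** — `HasStrictFDerivAt Ψ_t e_t 0` with `e_t` a continuous linear
  AUTOMORPHISM of `M₃(K)`, built against ONE inline `NormedRing ∕ NormedAlgebra` structure (the method of ★ `UltrametricElementwiseNormCalculus`).
[HarishChandra1970, Part V §4 Lemma 22] [Schikhof1984, §27 Lemma 27.4–Thm. 27.5]
HONEST LABEL: HC_CM is proved only modulo the 7 printed citations (2 remaining named inputs: hLiu418 = stmt-HodgeConjecture-24832, h413 = stmt-HodgeConjecture-24833)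
until rung 0 closes; count-neutral helper ((LBGL-ge3)∕(LBGL-3J) NOT ★ here).

## References
* [HarishChandra1970] Harish-Chandra (van Dijk), *Harmonic Analysis on Reductive p-adic Groups*, LNM 162 (1970), Part V §4 Lemma 22.
* [Schikhof1984] W. H. Schikhof, *Ultrametric Calculus* (1984), §27 Lemma 27.4–Thm. 27.5.
-/

set_option autoImplicit false
set_option linter.dupNamespace false

noncomputable section

open Filter Topology Set Matrix
open scoped MatrixGroups NNReal

namespace Summit.HodgeConjecture.HodgeConjecture.Cruxes.H413.K2E3GL3OrbitChartDeriv

/-! ## §1  Algebra: the three parts of a `3 × 3` matrix, the unipotent inverses, the chart as a conjugate -/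

section Algebra

variable {R : Type*} [CommRing R]

/-- `X = X⁺ + X⁻ + X_d` (strictly upper + strictly lower + diagonal parts). [folklore] -/
theorem upper_add_lower_add_diag (X : Matrix (Fin 3) (Fin 3) R) :
    (!![0, X 0 1, X 0 2; 0, 0, X 1 2; 0, 0, 0] : Matrix (Fin 3) (Fin 3) R) + !![0, 0, 0; X 1 0, 0, 0; X 2 0, X 2 1, 0] +
      Matrix.diagonal (fun i => X i i) = X := by
  ext i j; fin_cases i <;> fin_cases j <;> simp

/-- `(1 + X⁺)(1 − X⁺ + X⁺X⁺) = 1` (`(X⁺)³ = 0`). [folklore] -/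
theorem one_add_upper_mul_inv (X : Matrix (Fin 3) (Fin 3) R) :
    (1 + (!![0, X 0 1, X 0 2; 0, 0, X 1 2; 0, 0, 0] : Matrix (Fin 3) (Fin 3) R)) *
      (1 - !![0, X 0 1, X 0 2; 0, 0, X 1 2; 0, 0, 0] + !![0, X 0 1, X 0 2; 0, 0, X 1 2; 0, 0, 0] * !![0, X 0 1, X 0 2; 0, 0, X 1 2; 0, 0, 0]) = 1 := by
  ext i j; fin_cases i <;> fin_cases j <;> (simp [Matrix.mul_apply, Fin.sum_univ_three, Matrix.one_apply]; try ring)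

/-- `(1 − X⁺ + X⁺X⁺)(1 + X⁺) = 1`. [folklore] -/
theorem inv_mul_one_add_upper (X : Matrix (Fin 3) (Fin 3) R) :
    (1 - !![0, X 0 1, X 0 2; 0, 0, X 1 2; 0, 0, 0] + !![0, X 0 1, X 0 2; 0, 0, X 1 2; 0, 0, 0] * !![0, X 0 1, X 0 2; 0, 0, X 1 2; 0, 0, 0]) *
      (1 + (!![0, X 0 1, X 0 2; 0, 0, X 1 2; 0, 0, 0] : Matrix (Fin 3) (Fin 3) R)) = 1 := by
  ext i j; fin_cases i <;> fin_cases j <;> (simp [Matrix.mul_apply, Fin.sum_univ_three, Matrix.one_apply]; try ring)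

/-- `(1 + X⁻)(1 − X⁻ + X⁻X⁻) = 1` (`(X⁻)³ = 0`). [folklore] -/
theorem one_add_lower_mul_inv (X : Matrix (Fin 3) (Fin 3) R) :
    (1 + (!![0, 0, 0; X 1 0, 0, 0; X 2 0, X 2 1, 0] : Matrix (Fin 3) (Fin 3) R)) *
      (1 - !![0, 0, 0; X 1 0, 0, 0; X 2 0, X 2 1, 0] + !![0, 0, 0; X 1 0, 0, 0; X 2 0, X 2 1, 0] * !![0, 0, 0; X 1 0, 0, 0; X 2 0, X 2 1, 0]) = 1 := by
  ext i j; fin_cases i <;> fin_cases j <;> (simp [Matrix.mul_apply, Fin.sum_univ_three, Matrix.one_apply]; try ring)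

/-- `(1 − X⁻ + X⁻X⁻)(1 + X⁻) = 1`. [folklore] -/
theorem inv_mul_one_add_lower (X : Matrix (Fin 3) (Fin 3) R) :
    (1 - !![0, 0, 0; X 1 0, 0, 0; X 2 0, X 2 1, 0] + !![0, 0, 0; X 1 0, 0, 0; X 2 0, X 2 1, 0] * !![0, 0, 0; X 1 0, 0, 0; X 2 0, X 2 1, 0]) *
      (1 + (!![0, 0, 0; X 1 0, 0, 0; X 2 0, X 2 1, 0] : Matrix (Fin 3) (Fin 3) R)) = 1 := by
  ext i j; fin_cases i <;> fin_cases j <;> (simp [Matrix.mul_apply, Fin.sum_univ_three, Matrix.one_apply]; try ring)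

/-- **The group part of the chart is invertible**: `g(X) = (1 + X⁺)(1 + X⁻)` is a unit of `M₃(R)` with inverse `(1 + X⁻)⁻¹(1 + X⁺)⁻¹` — packaged as
`∃ g : GL₃(R)` with the two matrices displayed. [folklore] -/
theorem exists_unit_upper_lower (X : Matrix (Fin 3) (Fin 3) R) :
    ∃ g : GL (Fin 3) R,
      (g : Matrix (Fin 3) (Fin 3) R) = (1 + !![0, X 0 1, X 0 2; 0, 0, X 1 2; 0, 0, 0]) * (1 + !![0, 0, 0; X 1 0, 0, 0; X 2 0, X 2 1, 0]) ∧
      ((g⁻¹ : GL (Fin 3) R) : Matrix (Fin 3) (Fin 3) R) =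
        (1 - !![0, 0, 0; X 1 0, 0, 0; X 2 0, X 2 1, 0] + !![0, 0, 0; X 1 0, 0, 0; X 2 0, X 2 1, 0] * !![0, 0, 0; X 1 0, 0, 0; X 2 0, X 2 1, 0]) *
          (1 - !![0, X 0 1, X 0 2; 0, 0, X 1 2; 0, 0, 0] + !![0, X 0 1, X 0 2; 0, 0, X 1 2; 0, 0, 0] * !![0, X 0 1, X 0 2; 0, 0, X 1 2; 0, 0, 0]) := by
  set U : Matrix (Fin 3) (Fin 3) R := !![0, X 0 1, X 0 2; 0, 0, X 1 2; 0, 0, 0] with hU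
  set L : Matrix (Fin 3) (Fin 3) R := !![0, 0, 0; X 1 0, 0, 0; X 2 0, X 2 1, 0] with hL
  have h1 : (1 + U) * (1 + L) * ((1 - L + L * L) * (1 - U + U * U)) = 1 := by
    rw [Matrix.mul_assoc, ← Matrix.mul_assoc (1 + L), one_add_lower_mul_inv, Matrix.one_mul, one_add_upper_mul_inv]
  have h2 : (1 - L + L * L) * (1 - U + U * U) * ((1 + U) * (1 + L)) = 1 := by
    rw [Matrix.mul_assoc, ← Matrix.mul_assoc _ (1 + U), inv_mul_one_add_upper, Matrix.one_mul, inv_mul_one_add_lower]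
  exact ⟨⟨(1 + U) * (1 + L), (1 - L + L * L) * (1 - U + U * U), h1, h2⟩, rfl, rfl⟩

/-- `diagonal d + X_d = diagonal (d + diag X)`. [folklore] -/
theorem diagonal_add_diag (d : Fin 3 → R) (X : Matrix (Fin 3) (Fin 3) R) :
    Matrix.diagonal d + Matrix.diagonal (fun i => X i i) = Matrix.diagonal (d + fun i => X i i) :=
  (Matrix.diagonal_add d fun i => X i i)

/-- **The chart is a conjugate of a diagonal matrix**: `Ψ_t(X) = g · diagonal (d + diag X) · g⁻¹`, `g = (1+X⁺)(1+X⁻) ∈ GL₃`; hence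
`charpoly (Ψ_t X) = Π (T − (d_i + X_ii))`-type invariance. [cite: HarishChandra1970, Part V §4 Lemma 22] -/
theorem exists_orbitChart_eq_conj (d : Fin 3 → R) (X : Matrix (Fin 3) (Fin 3) R) :
    ∃ g : GL (Fin 3) R,
      (g : Matrix (Fin 3) (Fin 3) R) = (1 + !![0, X 0 1, X 0 2; 0, 0, X 1 2; 0, 0, 0]) * (1 + !![0, 0, 0; X 1 0, 0, 0; X 2 0, X 2 1, 0]) ∧
      (1 + !![0, X 0 1, X 0 2; 0, 0, X 1 2; 0, 0, 0]) * (1 + !![0, 0, 0; X 1 0, 0, 0; X 2 0, X 2 1, 0]) * (Matrix.diagonal d + Matrix.diagonal (fun i => X i i)) *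
          ((1 - !![0, 0, 0; X 1 0, 0, 0; X 2 0, X 2 1, 0] + !![0, 0, 0; X 1 0, 0, 0; X 2 0, X 2 1, 0] * !![0, 0, 0; X 1 0, 0, 0; X 2 0, X 2 1, 0]) *
            (1 - !![0, X 0 1, X 0 2; 0, 0, X 1 2; 0, 0, 0] + !![0, X 0 1, X 0 2; 0, 0, X 1 2; 0, 0, 0] * !![0, X 0 1, X 0 2; 0, 0, X 1 2; 0, 0, 0])) =
        (g : Matrix (Fin 3) (Fin 3) R) * Matrix.diagonal (d + fun i => X i i) * ((g⁻¹ : GL (Fin 3) R) : Matrix (Fin 3) (Fin 3) R) := by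
  obtain ⟨g, hg, hginv⟩ := exists_unit_upper_lower X
  exact ⟨g, hg, by rw [hg, hginv, diagonal_add_diag]⟩

/-- `charpoly (g Y g⁻¹) = charpoly Y` for `g ∈ GL₃` (Mathlib's `charpoly_units_conj` in the `↑(g⁻¹)` spelling). [folklore] -/
theorem charpoly_conj_units (g : GL (Fin 3) R) (Y : Matrix (Fin 3) (Fin 3) R) :
    ((g : Matrix (Fin 3) (Fin 3) R) * Y * ((g⁻¹ : GL (Fin 3) R) : Matrix (Fin 3) (Fin 3) R)).charpoly = Y.charpoly := by
  rw [Matrix.coe_units_inv]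
  exact Matrix.charpoly_units_conj g Y

/-- The entrywise value of the product-rule derivative of the chart at `0`: `(−tX⁺ − tX⁻ + X_d + (X⁻ + X⁺)t)_{ij} = c_{ij} X_{ij}` with `c_{ii} = 1`,
`c_{ij} = d_j − d_i`. [folklore] -/
theorem derivative_entry_formula (d : Fin 3 → R) (v : Matrix (Fin 3) (Fin 3) R) (i j : Fin 3) :
    (Matrix.diagonal d * -(!![0, v 0 1, v 0 2; 0, 0, v 1 2; 0, 0, 0] : Matrix (Fin 3) (Fin 3) R) +
        (Matrix.diagonal d * -(!![0, 0, 0; v 1 0, 0, 0; v 2 0, v 2 1, 0] : Matrix (Fin 3) (Fin 3) R) +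
          (Matrix.diagonal (fun i => v i i) +
            ((!![0, 0, 0; v 1 0, 0, 0; v 2 0, v 2 1, 0] : Matrix (Fin 3) (Fin 3) R) + !![0, v 0 1, v 0 2; 0, 0, v 1 2; 0, 0, 0]) * Matrix.diagonal d))) i j =
      (if i = j then (1 : R) else d j - d i) * v i j := by
  have hd : Matrix.diagonal d = !![d 0, 0, 0; 0, d 1, 0; 0, 0, d 2] := by
    ext a b; fin_cases a <;> fin_cases b <;> simp
  have hv : Matrix.diagonal (fun i => v i i) = !![v 0 0, 0, 0; 0, v 1 1, 0; 0, 0, v 2 2] := by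
    ext a b; fin_cases a <;> fin_cases b <;> simp
  rw [hd, hv]
  fin_cases i <;> fin_cases j <;> (simp; try ring)

/-- `Ψ_t(0) = t`. [folklore] -/
theorem orbitChart_zero (d : Fin 3 → R) :
    (fun X : Matrix (Fin 3) (Fin 3) R =>
        (1 + !![0, X 0 1, X 0 2; 0, 0, X 1 2; 0, 0, 0]) * (1 + !![0, 0, 0; X 1 0, 0, 0; X 2 0, X 2 1, 0]) *
          (Matrix.diagonal d + Matrix.diagonal (fun i => X i i)) *
          ((1 - !![0, 0, 0; X 1 0, 0, 0; X 2 0, X 2 1, 0] + !![0, 0, 0; X 1 0, 0, 0; X 2 0, X 2 1, 0] * !![0, 0, 0; X 1 0, 0, 0; X 2 0, X 2 1, 0]) *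
            (1 - !![0, X 0 1, X 0 2; 0, 0, X 1 2; 0, 0, 0] + !![0, X 0 1, X 0 2; 0, 0, X 1 2; 0, 0, 0] * !![0, X 0 1, X 0 2; 0, 0, X 1 2; 0, 0, 0]))) 0 =
      Matrix.diagonal d := by
  have hU : (!![0, (0 : Matrix (Fin 3) (Fin 3) R) 0 1, (0 : Matrix (Fin 3) (Fin 3) R) 0 2; 0, 0, (0 : Matrix (Fin 3) (Fin 3) R) 1 2; 0, 0, 0] :
      Matrix (Fin 3) (Fin 3) R) = 0 := by
    ext i j; fin_cases i <;> fin_cases j <;> rfl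
  have hL : (!![0, 0, 0; (0 : Matrix (Fin 3) (Fin 3) R) 1 0, 0, 0; (0 : Matrix (Fin 3) (Fin 3) R) 2 0, (0 : Matrix (Fin 3) (Fin 3) R) 2 1, 0] :
      Matrix (Fin 3) (Fin 3) R) = 0 := by
    ext i j; fin_cases i <;> fin_cases j <;> rfl
  have hD : Matrix.diagonal (fun i => (0 : Matrix (Fin 3) (Fin 3) R) i i) = 0 := Matrix.diagonal_zero
  simp only [hU, hL, hD, add_zero, sub_zero, Matrix.mul_zero, Matrix.one_mul, Matrix.mul_one]

end Algebra


/-! ## §2  Analysis over a complete ultrametric normed field `K` (elementwise sup norm on `M₃(K)`): the strict derivative of `Ψ_t` at `0` is the entrywise scaling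
equivalence `e_t` — §3 instantiates `K := F` with the valuation norm (R1 frame, inside proofs only) -/

section Normed

open scoped Matrix.Norms.Elementwise

variable {K : Type*} [NontriviallyNormedField K] [CompleteSpace K] [IsUltrametricDist K]

/-- **THE STRICT DERIVATIVE OF THE ORBIT CHART AT `0`.**  For `t = diagonal d` with `d` injective, the polynomial map
`Ψ_t(X) = (1 + X⁺)(1 + X⁻)(t + X_d)(1 − X⁻ + X⁻X⁻)(1 − X⁺ + X⁺X⁺)` on `M₃(K)` (elementwise sup norm, `K` complete ultrametric) has strict derivative at `0` the entrywise
scaling equivalence `(e_t X)_{ij} = (d_j − d_i) X_{ij}` (`i ≠ j`), `X_{ii}` (`i = j`) — product rule: `X⁺t + X⁻t + X_d − tX⁻ − tX⁺ = [X⁺ + X⁻, t] + X_d`.  All continuous linear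
maps are built against ONE inline `NormedRing ∕ NormedAlgebra` structure (the method of ★ `UltrametricElementwiseNormCalculus`), the statement is its definitional re-reading.
[cite: HarishChandra1970, Part V §4 Lemma 22] [cite: Schikhof1984, §27] -/
theorem hasStrictFDerivAt_orbitChart (d : Fin 3 → K) (hd : ∀ i j, i ≠ j → d i ≠ d j) :
    ∃ e : Matrix (Fin 3) (Fin 3) K ≃L[K] Matrix (Fin 3) (Fin 3) K,
      (∀ X i j, e X i j = (if i = j then (1 : K) else d j - d i) * X i j) ∧
      (∀ X i j, e.symm X i j = (if i = j then (1 : K) else d j - d i)⁻¹ * X i j) ∧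
      HasStrictFDerivAt (fun X : Matrix (Fin 3) (Fin 3) K =>
        (1 + !![0, X 0 1, X 0 2; 0, 0, X 1 2; 0, 0, 0]) * (1 + !![0, 0, 0; X 1 0, 0, 0; X 2 0, X 2 1, 0]) *
          (Matrix.diagonal d + Matrix.diagonal (fun i => X i i)) *
          ((1 - !![0, 0, 0; X 1 0, 0, 0; X 2 0, X 2 1, 0] + !![0, 0, 0; X 1 0, 0, 0; X 2 0, X 2 1, 0] * !![0, 0, 0; X 1 0, 0, 0; X 2 0, X 2 1, 0]) *
            (1 - !![0, X 0 1, X 0 2; 0, 0, X 1 2; 0, 0, 0] + !![0, X 0 1, X 0 2; 0, 0, X 1 2; 0, 0, 0] * !![0, X 0 1, X 0 2; 0, 0, X 1 2; 0, 0, 0])))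
        (e : Matrix (Fin 3) (Fin 3) K →L[K] Matrix (Fin 3) (Fin 3) K) 0 := by
  letI : NormedRing (Matrix (Fin 3) (Fin 3) K) :=
    { Matrix.normedAddCommGroup, (inferInstance : Ring (Matrix (Fin 3) (Fin 3) K)) with
      norm_mul_le := Literature.Analysis.Matrix.norm_mul_le_of_isUltrametricDist }
  letI : NormedAlgebra K (Matrix (Fin 3) (Fin 3) K) := { (inferInstance : Algebra K (Matrix (Fin 3) (Fin 3) K)) with norm_smul_le := norm_smul_le }
  haveI : CompleteSpace (Matrix (Fin 3) (Fin 3) K) := inferInstanceAs (CompleteSpace (Fin 3 → Fin 3 → K))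
  suffices key : ∃ e : Matrix (Fin 3) (Fin 3) K ≃L[K] Matrix (Fin 3) (Fin 3) K,
      (∀ X i j, e X i j = (if i = j then (1 : K) else d j - d i) * X i j) ∧
      (∀ X i j, e.symm X i j = (if i = j then (1 : K) else d j - d i)⁻¹ * X i j) ∧
      HasStrictFDerivAt (fun X : Matrix (Fin 3) (Fin 3) K =>
        (1 + !![0, X 0 1, X 0 2; 0, 0, X 1 2; 0, 0, 0]) * (1 + !![0, 0, 0; X 1 0, 0, 0; X 2 0, X 2 1, 0]) *
          (Matrix.diagonal d + Matrix.diagonal (fun i => X i i)) *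
          ((1 - !![0, 0, 0; X 1 0, 0, 0; X 2 0, X 2 1, 0] + !![0, 0, 0; X 1 0, 0, 0; X 2 0, X 2 1, 0] * !![0, 0, 0; X 1 0, 0, 0; X 2 0, X 2 1, 0]) *
            (1 - !![0, X 0 1, X 0 2; 0, 0, X 1 2; 0, 0, 0] + !![0, X 0 1, X 0 2; 0, 0, X 1 2; 0, 0, 0] * !![0, X 0 1, X 0 2; 0, 0, X 1 2; 0, 0, 0])))
        (e : Matrix (Fin 3) (Fin 3) K →L[K] Matrix (Fin 3) (Fin 3) K) 0 by exact key
  -- the scaling equivalence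
  have hc : ∀ i j : Fin 3, (if i = j then (1 : K) else d j - d i) ≠ 0 := by
    intro i j
    split_ifs with h
    · exact one_ne_zero
    · exact sub_ne_zero.2 (hd j i (Ne.symm h))
  let Le : Matrix (Fin 3) (Fin 3) K ≃ₗ[K] Matrix (Fin 3) (Fin 3) K :=
    { toFun := fun X => Matrix.of fun i j => (if i = j then (1 : K) else d j - d i) * X i j
      invFun := fun X => Matrix.of fun i j => (if i = j then (1 : K) else d j - d i)⁻¹ * X i j
      map_add' := fun X Y => by ext i j; simp only [Matrix.of_apply, Matrix.add_apply]; ring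
      map_smul' := fun a X => by ext i j; simp only [Matrix.of_apply, Matrix.smul_apply, smul_eq_mul, RingHom.id_apply]; ring
      left_inv := fun X => by ext i j; simp only [Matrix.of_apply]; rw [← mul_assoc, inv_mul_cancel₀ (hc i j), one_mul]
      right_inv := fun X => by ext i j; simp only [Matrix.of_apply]; rw [← mul_assoc, mul_inv_cancel₀ (hc i j), one_mul] }
  set e : Matrix (Fin 3) (Fin 3) K ≃L[K] Matrix (Fin 3) (Fin 3) K := Le.toContinuousLinearEquiv with he_def
  have he : ∀ X i j, e X i j = (if i = j then (1 : K) else d j - d i) * X i j := fun X i j => rfl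
  have hes : ∀ X i j, e.symm X i j = (if i = j then (1 : K) else d j - d i)⁻¹ * X i j := fun X i j => rfl
  refine ⟨e, he, hes, ?_⟩
  -- the parts as CLMs (finite dimension ⇒ continuous) and their strict derivatives
  let Lu : Matrix (Fin 3) (Fin 3) K →ₗ[K] Matrix (Fin 3) (Fin 3) K :=
    { toFun := fun X => !![0, X 0 1, X 0 2; 0, 0, X 1 2; 0, 0, 0]
      map_add' := fun X Y => by ext i j; fin_cases i <;> fin_cases j <;> simp
      map_smul' := fun a X => by ext i j; fin_cases i <;> fin_cases j <;> simp }
  let Ll : Matrix (Fin 3) (Fin 3) K →ₗ[K] Matrix (Fin 3) (Fin 3) K :=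
    { toFun := fun X => !![0, 0, 0; X 1 0, 0, 0; X 2 0, X 2 1, 0]
      map_add' := fun X Y => by ext i j; fin_cases i <;> fin_cases j <;> simp
      map_smul' := fun a X => by ext i j; fin_cases i <;> fin_cases j <;> simp }
  let Ld : Matrix (Fin 3) (Fin 3) K →ₗ[K] Matrix (Fin 3) (Fin 3) K :=
    { toFun := fun X => Matrix.diagonal fun i => X i i
      map_add' := fun X Y => (Matrix.diagonal_add (fun i => X i i) fun i => Y i i).symm
      map_smul' := fun a X => by ext i j; simp [Matrix.diagonal, Matrix.smul_apply] }
  set Pu : Matrix (Fin 3) (Fin 3) K →L[K] Matrix (Fin 3) (Fin 3) K := LinearMap.toContinuousLinearMap Lu with hPu_def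
  set Pl : Matrix (Fin 3) (Fin 3) K →L[K] Matrix (Fin 3) (Fin 3) K := LinearMap.toContinuousLinearMap Ll with hPl_def
  set Pd : Matrix (Fin 3) (Fin 3) K →L[K] Matrix (Fin 3) (Fin 3) K := LinearMap.toContinuousLinearMap Ld with hPd_def
  have hPu : ∀ X, Pu X = !![0, X 0 1, X 0 2; 0, 0, X 1 2; 0, 0, 0] := fun X => rfl
  have hPl : ∀ X, Pl X = !![0, 0, 0; X 1 0, 0, 0; X 2 0, X 2 1, 0] := fun X => rfl
  have hPd : ∀ X, Pd X = Matrix.diagonal fun i => X i i := fun X => rfl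
  have hA : HasStrictFDerivAt (fun X : Matrix (Fin 3) (Fin 3) K => (1 : Matrix (Fin 3) (Fin 3) K) + Pu X) Pu 0 := Pu.hasStrictFDerivAt.const_add 1
  have hB : HasStrictFDerivAt (fun X : Matrix (Fin 3) (Fin 3) K => (1 : Matrix (Fin 3) (Fin 3) K) + Pl X) Pl 0 := Pl.hasStrictFDerivAt.const_add 1
  have hC : HasStrictFDerivAt (fun X : Matrix (Fin 3) (Fin 3) K => Matrix.diagonal d + Pd X) Pd 0 := Pd.hasStrictFDerivAt.const_add _
  have hll := (Pl.hasStrictFDerivAt (x := (0 : Matrix (Fin 3) (Fin 3) K))).mul' (Pl.hasStrictFDerivAt (x := (0 : Matrix (Fin 3) (Fin 3) K)))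
  have huu := (Pu.hasStrictFDerivAt (x := (0 : Matrix (Fin 3) (Fin 3) K))).mul' (Pu.hasStrictFDerivAt (x := (0 : Matrix (Fin 3) (Fin 3) K)))
  have hB' := (Pl.hasStrictFDerivAt.const_sub (1 : Matrix (Fin 3) (Fin 3) K)).add hll
  have hA' := (Pu.hasStrictFDerivAt.const_sub (1 : Matrix (Fin 3) (Fin 3) K)).add huu
  -- the four products
  have h₂ := hA.mul' hB
  have h₃ := h₂.mul' hC
  have h₄ := h₃.mul' hB'
  have h₅ := h₄.mul' hA'
  -- identify the map and the derivative
  have hfun : (fun X : Matrix (Fin 3) (Fin 3) K =>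
        (1 + !![0, X 0 1, X 0 2; 0, 0, X 1 2; 0, 0, 0]) * (1 + !![0, 0, 0; X 1 0, 0, 0; X 2 0, X 2 1, 0]) *
          (Matrix.diagonal d + Matrix.diagonal (fun i => X i i)) *
          ((1 - !![0, 0, 0; X 1 0, 0, 0; X 2 0, X 2 1, 0] + !![0, 0, 0; X 1 0, 0, 0; X 2 0, X 2 1, 0] * !![0, 0, 0; X 1 0, 0, 0; X 2 0, X 2 1, 0]) *
            (1 - !![0, X 0 1, X 0 2; 0, 0, X 1 2; 0, 0, 0] + !![0, X 0 1, X 0 2; 0, 0, X 1 2; 0, 0, 0] * !![0, X 0 1, X 0 2; 0, 0, X 1 2; 0, 0, 0]))) =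
      ((((fun X : Matrix (Fin 3) (Fin 3) K => (1 : Matrix (Fin 3) (Fin 3) K) + Pu X) * fun X => (1 : Matrix (Fin 3) (Fin 3) K) + Pl X) *
          fun X => Matrix.diagonal d + Pd X) * fun X => (1 : Matrix (Fin 3) (Fin 3) K) - Pl X + Pl X * Pl X) *
        fun X => (1 : Matrix (Fin 3) (Fin 3) K) - Pu X + Pu X * Pu X := by
    funext X
    simp only [Pi.mul_apply, hPu, hPl, hPd, Matrix.mul_assoc]
  rw [hfun]
  refine h₅.congr_fderiv (ContinuousLinearMap.ext fun v => ?_)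
  have h0u : Pu 0 = 0 := map_zero _
  have h0l : Pl 0 = 0 := map_zero _
  have h0d : Pd 0 = 0 := map_zero _
  -- evaluate the product-rule derivative at `v`: `f x • g' + f' <• g x` pointwise, all base values `1` or `diagonal d`
  ext i j
  simp only [_root_.add_apply, _root_.smul_apply, _root_.neg_apply, Pi.add_apply, Pi.mul_apply, op_smul_eq_mul, smul_eq_mul,
    h0u, h0l, h0d, add_zero, mul_zero, mul_one, one_mul, sub_zero, MulOpposite.op_one, one_smul, MulOpposite.op_zero, zero_smul]
  refine Eq.trans ?_ (he v i j).symm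
  -- the remaining identity of concrete `3 × 3` matrices (§1), read through the definitional unfoldings `Pu v = X⁺` etc.
  exact derivative_entry_formula d v i j

end Normed




end Summit.HodgeConjecture.HodgeConjecture.Cruxes.H413.K2E3GL3OrbitChartDeriv

end
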